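import Summits.HodgeConjecture.HodgeConjecture.Theorems.Ring2TransportAutDescent
import Summits.HodgeConjecture.HodgeConjecture.Theorems.Ring2TransportAutConjugation
import Summits.HodgeConjecture.HodgeConjecture.Theorems.Ring2TransportCMTypeOfCommutativeMumfordTate
import Summits.HodgeConjecture.HodgeConjecture.Theorems.Ring2HypothesesDeligneTorus
import Literature.AlgebraicGeometry.HodgeTheory.AbelianVarietyHodgeFullnessRecord
import Literature.AlgebraicGeometry.HodgeTheory.AbelianVarietyHodgeHomFullness
import Literature.AlgebraicGeometry.HodgeTheory.ComplexConjugationHolds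
import HarnessLib

/-!
# Ring 2 transport — the junction `DeligneMilne1982_Thm_6_20_full → HodgeGroupH1CommutantSpan`
(Riemann's theorem ⟹ the residual R of node 44; part C of 3: assembly)

research route conditional on HC_CM; not a corollary; Q11.4-sentence-2 already refuted in dim ≥ 3.

Cell `pub-hodge-ring2`, seat `transport`, gen 52; helper file riding `--supports` the umbrella
`Theses.RankFourFaces.CMToAbelian`. LEAD ruling L41.7 (1): «a typed junction would be an EDGE
`DeligneMilne1982_Thm_6_20_full → R` in a transport file, never a second Riemann record nor a BINDER-OWNERS row».
This file IS that edge. R = `HodgeGroupH1CommutantSpan` (gen 51, part 4 of node 44: the commutant of the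
tree's Tannaka-free `Hg(A)(ℂ)` on `H¹(A(ℂ); ℂ)` is spanned by the pull-backs `φ^*`, `φ ∈ End A`) is DERIVED from
the tree's cited record of Riemann's theorem in the Deligne–Milne form (`DeligneMilne1982_Thm_6_20_full`: a
`ℚ`-linear map `H¹(B; ℚ) → H¹(A; ℚ)` respecting the Hodge types `(1,0)`, `(0,1)` is a positive multiple of some
`u^*`, `u : A ⟶ B`) along Deligne's own road (LNM 900, I §3 proof of Prop. 3.4 and I §5 proof of Prop. 5.1):

1. (§A, `Ring2TransportAutDescent`) the commutant `W` of `Hg(A)(ℂ)` in `End_ℂ H¹(A(ℂ); ℂ)` is spanned by its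
   elements with RATIONAL matrix in a basis `bᵢ ⊗ 1`, because (§B, `Ring2TransportAutConjugation`) it is stable
   under `x ↦ θ_σ x θ_σ⁻¹` for every `σ ∈ Aut(ℂ)` — `Hg` is `Aut(ℂ)`-stable — and the fixed field of `Aut(ℂ)` is `ℚ`
   («`{σμ}` stable, hence defined over `ℚ`», I §3);
2. a rational element of `W` is `β ∘ (x₀ ⊗ ℂ) ∘ β⁻¹` for a `ℚ`-endomorphism `x₀` of `H¹(A(ℂ); ℚ)`, and `x₀`
   respects the Hodge types: `W` commutes with Deligne's torus element `T = ∑ 2^{p-q} π_{(p,q)} ∈ Hg(A)(ℂ)`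
   (the tree's `Ring2.Hypotheses.exists_mem_hodgeGroup_torus`, «`h(U¹) ⊂ Hg`», I §3), whose eigenspaces on `H¹`
   are exactly `H^{1,0}` and `H^{0,1}`;
3. Riemann (`DeligneMilne1982_Thm_6_20_full`, B := A): `k • x₀ = u^*` for some `u ∈ End A`, `k > 0`; hence the
   rational element is `k⁻¹ • u^* ∈ span{φ^*}` («E is the commutant of G», I §5 proof of 5.1).

WHAT IS PROVED (theorems only: no `sorry`, no new axiom, no named fact, no `def`):
* `hodgeGroupH1CommutantSpan_of_riemann : DeligneMilne1982_Thm_6_20_full → HodgeGroupH1CommutantSpan` — THE EDGE;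
* `cmTypeIffMumfordTateCommutative_of_riemann : DeligneMilne1982_Thm_6_20_full → CMTypeIffMumfordTateCommutative`
  (node 44 «of CM-type iff MT commutative», composed with gen 51's edge
  `cmTypeIffMumfordTateCommutative_of_hodgeGroupH1CommutantSpan`): node 44 now rests on ONE cited classical
  theorem (Riemann, in print since 1982 in this form) instead of the internally minted residual R;
* the two Hodge-theoretic lemmas of step 2 (`isOfHodgeType_of_torusSum_apply_eq_smul`,
  `isOfHodgeType_apply_of_commute_torusSum`) for any Hodge model.
What is NOT proved: Riemann's theorem itself (a cited record, hypothesis `hRiemann` everywhere); HC_CM.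

References: P. Deligne, *Hodge cycles on abelian varieties*, LNM 900 (1982), I §3 Prop. 3.4 (and the definition
of `Hg` before Thm. 3.8), I §5 Prop. 5.1 [Deligne1982HodgeCycles]; P. Deligne, J. Milne, *Tannakian categories*,
LNM 900 (1982), II Thm. 6.20 [DeligneMilne1982Tannakian]; H. Lange, *Abelian Varieties over the Complex Numbers*
(2023), Prop. 1.1.6(b), Thm. 1.1.21 [Lange2023AbelianVarietiesComplex]; B. van Geemen, *An introduction to the
Hodge conjecture for abelian varieties* (1994), 6.4–6.6 [vanGeemen1994HodgeAV].
-/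

set_option linter.dupNamespace false

noncomputable section

open CategoryTheory MonoidalCategory CartesianMonoidalCategory
open Literature.AlgebraicTopology.SingularHomology
open Literature.AlgebraicGeometry Literature.AlgebraicGeometry.Motives
open Literature.AlgebraicGeometry.HodgeTheory
open Summit.HodgeConjecture.HodgeConjecture.Ring2.Hypotheses
open scoped TensorProduct

namespace Summit.HodgeConjecture.HodgeConjecture.Ring2Transport

/-! ## §C1 Eigenvectors of Deligne's torus element are of pure Hodge type -/

section Torus

variable {m : ℕ} {Y : SchemeOver ℂ}

/-- `u = 2` separates ALL Hodge types of a given weight: `2ᵖ 2^{-q} = 2^{p'} 2^{-q'}` and `p + q = p' + q'` force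
`p = p'` (the tree's `two_torusSeparates` is the case `(p', q') = (q, p)`). [folklore] -/
theorem two_torusSeparates_of_sum_eq (p q p' q' : ℕ) (hs : p + q = p' + q')
    (h : ((Units.mk0 (2 : ℂ) two_ne_zero : ℂˣ) : ℂ) ^ p * ((((Units.mk0 (2 : ℂ) two_ne_zero)⁻¹ : ℂˣ) : ℂ) ^ q) =
      ((Units.mk0 (2 : ℂ) two_ne_zero : ℂˣ) : ℂ) ^ p' * ((((Units.mk0 (2 : ℂ) two_ne_zero)⁻¹ : ℂˣ) : ℂ) ^ q')) :
    p = p' := by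
  simp only [Units.val_inv_eq_inv_val, Units.val_mk0, inv_pow] at h
  have h2 : ∀ n : ℕ, (2 : ℂ) ^ n ≠ 0 := fun n => pow_ne_zero n two_ne_zero
  rw [← div_eq_mul_inv, ← div_eq_mul_inv, div_eq_div_iff (h2 q) (h2 q'), ← pow_add, ← pow_add] at h
  have h' : p + q' = p' + q := Nat.pow_right_injective (le_refl 2) (by exact_mod_cast h)
  omega

/-- **An eigenvector of the torus operator `T_{u,u⁻¹} = ∑ uᵖ u^{-q} π_{(p,q)}` with eigenvalue `uᵖ u^{-q}` is of
Hodge type `(p,q)`** when `u` separates the types of weight `k = p + q` (e.g. `u = 2`): the other type components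
are eigenvectors for different eigenvalues, hence vanish by uniqueness of the Hodge decomposition
(van Geemen 6.6 / Deligne I 3.4 for the eigenvalue `1`; the tree's `isOfHodgeType_of_torusSum_apply_eq_self`).
[cite: vanGeemen1994HodgeAV, proof of Thm. 6.6] [cite: Deligne1982HodgeCycles, I §3 Prop. 3.4] -/
theorem isOfHodgeType_of_torusSum_apply_eq_smul (M : HodgeModel m Y) {u : ℂˣ}
    (hu : ∀ p q p' q' : ℕ, p + q = p' + q' →
      ((u : ℂ) ^ p) * (((u⁻¹ : ℂˣ) : ℂ) ^ q) = ((u : ℂ) ^ p') * (((u⁻¹ : ℂˣ) : ℂ) ^ q') → p = p')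
    {k p q : ℕ} (hpq : p + q = k) {z : complexBetti Y k}
    (h : (∑ pq : ↥(Finset.HasAntidiagonal.antidiagonal k),
        (((u : ℂ) ^ pq.1.1) * (((u⁻¹ : ℂˣ) : ℂ) ^ pq.1.2)) • M.typeProj k pq) z =
      (((u : ℂ) ^ p) * (((u⁻¹ : ℂˣ) : ℂ) ^ q)) • z) :
    IsOfHodgeType m Y k p q z := by
  classical
  have hmem : (p, q) ∈ Finset.HasAntidiagonal.antidiagonal k :=
    Finset.HasAntidiagonal.mem_antidiagonal.2 hpq
  rw [torusSum_apply] at h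
  have hproj : ∀ pq : ↥(Finset.HasAntidiagonal.antidiagonal k),
      M.typeProj k pq ((((u : ℂ) ^ p) * (((u⁻¹ : ℂˣ) : ℂ) ^ q)) • z) =
        (((u : ℂ) ^ pq.1.1) * (((u⁻¹ : ℂˣ) : ℂ) ^ pq.1.2)) • M.typeProj k pq z :=
    fun pq ↦ M.typeProj_eq_of_sum_eq
      (y := fun pq ↦ (((u : ℂ) ^ pq.1.1) * (((u⁻¹ : ℂˣ) : ℂ) ^ pq.1.2)) • M.typeProj k pq z)
      (fun pq ↦ Submodule.smul_mem _ _ (M.typeProj_mem _ pq z)) h pq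
  have hzero : ∀ pq : ↥(Finset.HasAntidiagonal.antidiagonal k), pq ≠ ⟨(p, q), hmem⟩ →
      M.typeProj k pq z = 0 := by
    intro pq hne
    have hsum : pq.1.1 + pq.1.2 = k := Finset.HasAntidiagonal.mem_antidiagonal.1 pq.2
    have hκ : ((u : ℂ) ^ pq.1.1) * (((u⁻¹ : ℂˣ) : ℂ) ^ pq.1.2) ≠ ((u : ℂ) ^ p) * (((u⁻¹ : ℂˣ) : ℂ) ^ q) := by
      intro heq
      apply hne
      have hp : pq.1.1 = p := hu _ _ _ _ (hsum.trans hpq.symm) heq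
      have hq : pq.1.2 = q := by omega
      exact Subtype.ext (Prod.ext hp hq)
    have h2 : ((((u : ℂ) ^ pq.1.1) * (((u⁻¹ : ℂˣ) : ℂ) ^ pq.1.2)) - ((u : ℂ) ^ p) * (((u⁻¹ : ℂˣ) : ℂ) ^ q)) •
        M.typeProj k pq z = 0 := by
      rw [sub_smul, ← hproj pq, map_smul, sub_self]
    rcases smul_eq_zero.1 h2 with h3 | h3
    · exact absurd (sub_eq_zero.1 h3) hκ
    · exact h3
  have hz : z = M.typeProj k ⟨(p, q), hmem⟩ z := by
    conv_lhs => rw [← M.sum_typeProj k z]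
    rw [Finset.sum_eq_single ⟨(p, q), hmem⟩ (fun pq _ hne ↦ hzero pq hne) (fun h ↦ absurd (Finset.mem_univ _) h)]
  -- elaborate the witness first (no expected type): `(↑⟨(p,q),_⟩).1` reduces to `p`
  have key := M.isOfHodgeType_of_mem_typePiece (M.typeProj_mem k ⟨(p, q), hmem⟩ z)
  rw [hz]
  exact key

/-- **An endomorphism commuting with the torus operator preserves every Hodge type** (`u` separating, `Y` smooth
projective so that the types do not depend on the model): if `x T = T x` and `c` is of type `(p,q)`, then
`T (x c) = x (uᵖ u^{-q} c) = uᵖ u^{-q} (x c)`. This is the Hodge-theoretic content of «the commutant of `Hg(A)` consists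
of morphisms of Hodge structures» (Deligne I §3: `h(U¹) ⊂ Hg`). [cite: Deligne1982HodgeCycles, I §3 Prop. 3.4 and §5 proof of Prop. 5.1] -/
theorem isOfHodgeType_apply_of_commute_torusSum (M : HodgeModel m Y) (hY : IsSmoothProjective m Y) {u : ℂˣ}
    (hu : ∀ p q p' q' : ℕ, p + q = p' + q' →
      ((u : ℂ) ^ p) * (((u⁻¹ : ℂˣ) : ℂ) ^ q) = ((u : ℂ) ^ p') * (((u⁻¹ : ℂˣ) : ℂ) ^ q') → p = p')
    {k : ℕ} (x : complexBetti Y k →ₗ[ℂ] complexBetti Y k)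
    (hx : ∀ c : complexBetti Y k,
      x ((∑ pq : ↥(Finset.HasAntidiagonal.antidiagonal k),
          (((u : ℂ) ^ pq.1.1) * (((u⁻¹ : ℂˣ) : ℂ) ^ pq.1.2)) • M.typeProj k pq) c) =
        (∑ pq : ↥(Finset.HasAntidiagonal.antidiagonal k),
          (((u : ℂ) ^ pq.1.1) * (((u⁻¹ : ℂˣ) : ℂ) ^ pq.1.2)) • M.typeProj k pq) (x c))
    {p q : ℕ} (hpq : p + q = k) {c : complexBetti Y k} (hc : IsOfHodgeType m Y k p q c) :
    IsOfHodgeType m Y k p q (x c) := by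
  apply isOfHodgeType_of_torusSum_apply_eq_smul M hu hpq
  rw [← hx c, torusSum_apply_of_isOfHodgeType M hY u u⁻¹ hpq hc, map_smul]

end Torus

/-! ## §C2 The edge: Riemann's theorem ⟹ R -/

section Edge

/-- **THE JUNCTION `DeligneMilne1982_Thm_6_20_full → HodgeGroupH1CommutantSpan`** (Deligne I §3 Prop. 3.4 + §5 proof
of Prop. 5.1, «`E = End⁰(A)` is the commutant of `G = Hg(A)`», on the tree's Tannaka-free carriers). Let `x` be a
`ℂ`-endomorphism of `H¹(A(ℂ); ℂ)` commuting with `Hg(A)(ℂ)|_{H¹}`. The commutant `W` is a `ℂ`-subspace stable under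
`Aut(ℂ)`-conjugation (§B: `Hg` is `Aut(ℂ)`-stable), so by Galois descent (§A: the fixed field of `Aut(ℂ)` is `ℚ`)
`x` is a `ℂ`-combination of elements `x'` of `W` with rational matrix, i.e. `x' = β (x₀ ⊗ ℂ) β⁻¹` for a
`ℚ`-endomorphism `x₀` of `H¹(A(ℂ); ℚ)`; `x'` commutes with the torus element `T_{2,1/2} ∈ Hg(A)(ℂ)` (§C1), so `x₀`
respects the types `(1,0)` and `(0,1)`, and Riemann's theorem (the record `DeligneMilne1982_Thm_6_20_full`, with
`B = A` and the Hodge model supplied by `nonempty_hodgeModel_holds`) gives `u ∈ End A`, `k > 0` with `u^* = k x₀`;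
hence `x' = k⁻¹ u^*` lies in the span of the pull-backs. [cite: Deligne1982HodgeCycles, I §3 Prop. 3.4 and I §5 Prop. 5.1 (proof)]
[cite: DeligneMilne1982Tannakian, II Thm. 6.20] [cite: Lange2023AbelianVarietiesComplex, Prop. 1.1.6(b) and Thm. 1.1.21] -/
theorem hodgeGroupH1CommutantSpan_of_riemann (hRiemann : DeligneMilne1982_Thm_6_20_full) :
    HodgeGroupH1CommutantSpan := by
  classical
  intro A x hx
  haveI : Module.Finite ℚ (bettiCohomology A.X 1) := finite_bettiCohomology_one A
  have hX := AbelianVariety.isSmoothProjective_holds (A := A)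
  let b := Module.finBasis ℚ (bettiCohomology A.X 1)
  -- the commutant of `Hg(A)(ℂ)` on `H¹(A(ℂ); ℂ)`
  let W : Submodule ℂ (complexBetti A.X 1 →ₗ[ℂ] complexBetti A.X 1) :=
    { carrier := {x | ∀ g ∈ hodgeGroup A.dim A.X, ∀ y : complexBetti A.X 1, x (g 1 y) = g 1 (x y)}
      add_mem' := fun {x x'} hx hx' g hg y => by
        rw [LinearMap.add_apply, LinearMap.add_apply, hx g hg y, hx' g hg y, map_add]
      zero_mem' := fun g hg y => by rw [LinearMap.zero_apply, LinearMap.zero_apply, map_zero]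
      smul_mem' := fun c x hx g hg y => by
        rw [LinearMap.smul_apply, LinearMap.smul_apply, hx g hg y, map_smul] }
  have hxW : x ∈ W := hx
  -- §B: `W` is stable under conjugation by `θ_σ`, which acts entrywise by `σ` in the basis `bᵢ ⊗ 1`
  have hW : ∀ τ : ℂ ≃ₐ[ℚ] ℂ, ∀ x ∈ W, ∃ x' ∈ W, ∀ i j,
      ((Algebra.TensorProduct.basis ℂ b).map (ofRatClassBaseChangeEquiv hX 1)).repr
          (x' (((Algebra.TensorProduct.basis ℂ b).map (ofRatClassBaseChangeEquiv hX 1)) j)) i =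
        τ (((Algebra.TensorProduct.basis ℂ b).map (ofRatClassBaseChangeEquiv hX 1)).repr
          (x (((Algebra.TensorProduct.basis ℂ b).map (ofRatClassBaseChangeEquiv hX 1)) j)) i) := by
    intro τ x hxW
    set σ : ℂ ≃+* ℂ := (τ : ℂ ≃+* ℂ).symm with hσ
    -- `x' = θ_σ⁻¹ ∘ x ∘ θ_σ`
    let x' : complexBetti A.X 1 →ₗ[ℂ] complexBetti A.X 1 :=
      { toFun := fun y => coeffClass (R := ℂ) (S := ℂ) (σ.symm : ℂ →+* ℂ).toAddMonoidHom 1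
          (x (coeffClass (R := ℂ) (S := ℂ) (σ : ℂ →+* ℂ).toAddMonoidHom 1 y))
        map_add' := fun y y' => by simp only [map_add]
        map_smul' := fun z y => by
          rw [RingHom.id_apply, coeffClass_ringEquiv_smul, map_smul, coeffClass_ringEquiv_smul,
            σ.symm_apply_apply] }
    have hx'apply : ∀ y, x' y = coeffClass (R := ℂ) (S := ℂ) (σ.symm : ℂ →+* ℂ).toAddMonoidHom 1
        (x (coeffClass (R := ℂ) (S := ℂ) (σ : ℂ →+* ℂ).toAddMonoidHom 1 y)) := fun y => rfl
    refine ⟨x', fun g hg y => ?_, fun i j => ?_⟩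
    · obtain ⟨g', hg', -, hgapply⟩ := exists_conj_mem_hodgeGroup σ hg
      rw [hx'apply, hx'apply, hgapply 1 y, coeffClass_ringEquiv_apply_symm, hxW g' hg',
        hgapply 1 (coeffClass (R := ℂ) (S := ℂ) (σ.symm : ℂ →+* ℂ).toAddMonoidHom 1 _),
        coeffClass_ringEquiv_apply_symm]
    · have hfix : coeffClass (R := ℂ) (S := ℂ) (σ : ℂ →+* ℂ).toAddMonoidHom 1
          (((Algebra.TensorProduct.basis ℂ b).map (ofRatClassBaseChangeEquiv hX 1)) j) =
            ((Algebra.TensorProduct.basis ℂ b).map (ofRatClassBaseChangeEquiv hX 1)) j := by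
        rw [basis_map_ofRatClassBaseChangeEquiv_apply, coeffClass_ringEquiv_ofRatClass]
      rw [hx'apply, hfix, basis_repr_coeffClass_ringEquiv hX 1 b σ.symm, hσ, RingEquiv.symm_symm]
      rfl
  -- §A: `x` is a `ℂ`-combination of elements of `W` with rational entries
  have hspan := Descent.mem_span_ratEntries_of_stable (K := ℚ) (C := ℂ)
    (fun c hc => Descent.mem_range_algebraMap_rat_of_forall_algEquiv hc)
    ((Algebra.TensorProduct.basis ℂ b).map (ofRatClassBaseChangeEquiv hX 1)) W hW x hxW
  refine (Submodule.span_le.2 ?_) hspan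
  rintro x' ⟨hx'W, hx'rat⟩
  -- a rational element of the commutant: `x' = β (x₀ ⊗ ℂ) β⁻¹`
  obtain ⟨x₀, hx₀⟩ := Descent.exists_eq_baseChange_of_ratEntries (K := ℚ) (C := ℂ) b
    (ofRatClassBaseChangeEquiv hX 1) x' hx'rat
  -- §C1: `x₀` respects the Hodge types, through the torus element `T_{2,1/2} ∈ Hg(A)(ℂ)`
  let M : ∀ a : ℕ, HodgeModel (cartesianPowDim A.dim a) (cartesianPow A.X (a + 1)) :=
    fun a => Classical.choice (nonempty_hodgeModel_holds (isSmoothProjective_cartesianPow hX a))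
  obtain ⟨g, hg, G, -, rfl, hGapply⟩ := exists_mem_hodgeGroup_torus hX M (Units.mk0 (2 : ℂ) two_ne_zero)
  have hxT : ∀ c : complexBetti A.X 1,
      x' ((∑ pq : ↥(Finset.HasAntidiagonal.antidiagonal 1),
          ((((Units.mk0 (2 : ℂ) two_ne_zero : ℂˣ) : ℂ) ^ pq.1.1) *
            ((((Units.mk0 (2 : ℂ) two_ne_zero)⁻¹ : ℂˣ) : ℂ) ^ pq.1.2)) • (M 0).typeProj 1 pq) c) =
        (∑ pq : ↥(Finset.HasAntidiagonal.antidiagonal 1),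
          ((((Units.mk0 (2 : ℂ) two_ne_zero : ℂˣ) : ℂ) ^ pq.1.1) *
            ((((Units.mk0 (2 : ℂ) two_ne_zero)⁻¹ : ℂˣ) : ℂ) ^ pq.1.2)) • (M 0).typeProj 1 pq) (x' c) := by
    intro c
    rw [← hGapply 0 1 c, ← hGapply 0 1 (x' c)]
    exact hx'W (G 0) hg c
  have htype : ∀ {p q : ℕ}, p + q = 1 → ∀ {c : complexBetti A.X 1},
      IsOfHodgeType A.dim A.X 1 p q c → IsOfHodgeType A.dim A.X 1 p q (x' c) :=
    fun hpq c hc => isOfHodgeType_apply_of_commute_torusSum (M 0) (isSmoothProjective_cartesianPow hX 0)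
      (two_torusSeparates_of_sum_eq) x' hxT hpq hc
  have hHodge : IsHodgeMorphismOne A A x₀ := by
    refine ⟨fun t ht => ?_, fun t ht => ?_⟩
    · have h1 := htype (p := 1) (q := 0) rfl (c := ofRatClassBaseChangeEquiv hX 1 t) ht
      rw [hx₀ t] at h1
      exact h1
    · have h1 := htype (p := 0) (q := 1) rfl (c := ofRatClassBaseChangeEquiv hX 1 t) ht
      rw [hx₀ t] at h1
      exact h1
  -- Riemann: `u^* = k • x₀` on `H¹(A(ℂ); ℚ)`
  obtain ⟨uA, k, hk, huA⟩ := hRiemann A A x₀ (nonempty_hodgeModel_holds hX) hHodge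
  have hmapQ : (bettiCohomology.map uA.hom.hom.hom 1).hom = ((k : ℚ)) • x₀ := by
    apply LinearMap.ext
    intro v
    rw [LinearMap.smul_apply, Nat.cast_smul_eq_nsmul]
    exact huA v
  have hk0 : (k : ℂ) ≠ 0 := Nat.cast_ne_zero.2 hk.ne'
  -- hence `u^* = k • x'` on `H¹(A(ℂ); ℂ)`
  have hmapC : (complexBetti.map uA.hom.hom.hom 1).hom = (k : ℂ) • x' := by
    apply LinearMap.ext
    intro y
    obtain ⟨t, rfl⟩ := (ofRatClassBaseChangeEquiv hX 1).surjective y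
    change complexBetti.map uA.hom.hom.hom 1 (ofRatClassBaseChangeEquiv hX 1 t) =
      (k : ℂ) • x' (ofRatClassBaseChangeEquiv hX 1 t)
    rw [complexBetti_map_ofRatClassBaseChangeEquiv hX hX, hmapQ, LinearMap.baseChange_smul, LinearMap.smul_apply,
      ← algebraMap_smul ℂ (k : ℚ) (x₀.baseChange ℂ t), map_smul, map_natCast, hx₀ t]
  have hx'eq : x' = (k : ℂ)⁻¹ • (complexBetti.map uA.hom.hom.hom 1).hom := by
    rw [hmapC, inv_smul_smul₀ hk0]
  rw [SetLike.mem_coe, hx'eq]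
  exact Submodule.smul_mem _ _ (Submodule.subset_span ⟨uA, rfl⟩)

/-- The edge as an implication between the two named statements (binder census). [folklore] -/
theorem riemann_imp_hodgeGroupH1CommutantSpan :
    DeligneMilne1982_Thm_6_20_full → HodgeGroupH1CommutantSpan :=
  hodgeGroupH1CommutantSpan_of_riemann

/-- **Node 44 from Riemann's theorem**: «an abelian variety is of CM-type iff its Mumford–Tate group is
commutative» (`CMTypeIffMumfordTateCommutative`, Deligne I §5 Prop. 5.1) follows from the cited record of
Riemann's theorem alone — gen 51's edge `R → node 44` composed with this file's `Riemann → R`.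
[cite: Deligne1982HodgeCycles, I §5 Prop. 5.1] [cite: DeligneMilne1982Tannakian, II Thm. 6.20]
[status: conditional on DeligneMilne1982_Thm_6_20_full] -/
theorem cmTypeIffMumfordTateCommutative_of_riemann (hRiemann : DeligneMilne1982_Thm_6_20_full) :
    CMTypeIffMumfordTateCommutative :=
  cmTypeIffMumfordTateCommutative_of_hodgeGroupH1CommutantSpan (hodgeGroupH1CommutantSpan_of_riemann hRiemann)

end Edge

/-! ## Audit: the edge carries `DeligneMilne1982_Thm_6_20_full` as its only hypothesis; std axioms only. -/

#print axioms Summit.HodgeConjecture.HodgeConjecture.Ring2Transport.hodgeGroupH1CommutantSpan_of_riemann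
#print axioms Summit.HodgeConjecture.HodgeConjecture.Ring2Transport.cmTypeIffMumfordTateCommutative_of_riemann

end Summit.HodgeConjecture.HodgeConjecture.Ring2Transport

end
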